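import Summits.NavierStokesRegularity.NavierStokesRegularity.Theses.ClockStretchingLaw
import Summits.NavierStokesRegularity.NavierStokesRegularity.Theorems.ClockStretchingLawClockCeilingStubUniformBounds
import Summits.NavierStokesRegularity.NavierStokesRegularity.Theorems.ClockStretchingLawClockCeilingStubZoomCompactness
import Summits.NavierStokesRegularity.NavierStokesRegularity.Theorems.ClockStretchingLawClockCeilingStubBoostLiouville
import Summits.NavierStokesRegularity.NavierStokesRegularity.Theorems.ClockStretchingLawClockCeilingStubShearRigidity
import Summits.NavierStokesRegularity.NavierStokesRegularity.Theorems.ClockStretchingLawClockCeilingStubShearLiouville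
import Literature.Analysis.FluidPDE.ClassicalSuitable
import HarnessLib

/-!
# `ClockStretchingLaw.ClockCeiling`, line `registered` — frame rigidity under a clock floor
# (`stub_frameRigidity`, through the composition `stub_frameRigidity_of`)

Route `route-NavierStokesRegularity-ClockStretchingLaw`, crux `ClockCeiling`
(stmt-NavierStokesRegularity-10570). This file proves the COMPOSITION stub of the reshaped birth
skeleton: the statements of the five analytic stubs (uniform scale-invariant bounds, zoom
compactness with continuous convergence of the frame form, boost Liouville, shear rigidity, shear
Liouville), taken verbatim as hypotheses, imply FRAME RIGIDITY UNDER A CLOCK FLOOR: if the clock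
amplitude `a_u(t) = (-t)^{3/2} ∫ ‖∂ₜu‖² ρ_t` of a class element is `≥ δ > 0` on `[-1, 0)`, then the
frame form `frame_u(t; c₀, b) = √(-t) ∫ ‖(c₀√(-t)) • ∂ₜu + ∂_b u‖² ρ_t` is bounded below by some
`η > 0` uniformly in `t ∈ [-1, 0)` and `(c₀, b)` on the unit sphere of `ℝ × ℝ³`.

The proof is pure logic, elementary topology and one Gaussian integrability; no PDE:

* negate and `choose` a degenerating sequence `(tₙ, cₙ, bₙ)`, `frame_u(tₙ; cₙ, bₙ) < 1/(n+1)`;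
* extract `(cₙ, bₙ) → (c*, b*)` on the compact closed unit ball of `ℝ × ℝ³`, `c*² + ‖b*‖² = 1`;
* zoom with `Λₙ = √(-tₙ)`: the zoom-compactness hypothesis produces a class element `v` with
  continuous convergence of the frame form; since `frame(·; 1, 0)` is the amplitude
  (`frameRigidityOf_frame_one_zero`) the floor passes to `v` at `t = -1`, while
  `frame_v(-1; c*, b*) = 0` by the squeeze `0 ≤ frame < 1/(n+1)`;
* the integrand of the vanishing frame is continuous, nonnegative and integrable (sup bounds of
  the class and the Gaussian), hence identically zero (`frameRigidityOf_eq_zero_of_frame_eq_zero`);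
* `c* ≠ 0`: boost Liouville; `c* = 0`: shear rigidity then shear Liouville; either way `v ≡ 0`,
  so `a_v(-1) = 0 < δ ≤ a_v(-1)`.

No new definitions. [folklore]
-/

set_option linter.dupNamespace false

noncomputable section

namespace Summit.NavierStokesRegularity.NavierStokesRegularity.Theorems

open scoped Topology InnerProductSpace
open MeasureTheory Filter Set
open Literature.Analysis.FluidPDE

/-- The Gaussian `x ↦ e^{-b‖x‖²}` is integrable on `ℝ³` for `b > 0` (Mathlib's complex Gaussian
`GaussianFourier.integrable_cexp_neg_mul_sq_norm_add`, real part). [folklore] -/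
theorem frameRigidityOf_integrable_exp_neg_mul_sq_norm {b : ℝ} (hb : 0 < b) :
    Integrable fun x : (EuclideanSpace ℝ (Fin 3)) => Real.exp (-b * ‖x‖ ^ 2) := by
  -- adapted from Literature/Analysis/Complex/TubeFourierWindow.lean (`integrable_exp_neg_mul_sq_norm`)
  have h := GaussianFourier.integrable_cexp_neg_mul_sq_norm_add (V := (EuclideanSpace ℝ (Fin 3))) (b := b)
    (by simpa using hb) 0 0
  simp only [zero_mul, add_zero] at h
  refine h.norm.congr (Eventually.of_forall fun x => ?_)
  simp only [Complex.norm_exp]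
  congr 1
  rw [show (-(b : ℂ) * ((‖x‖ : ℂ)) ^ 2) = (((-b * ‖x‖ ^ 2 : ℝ)) : ℂ) by push_cast; ring]
  exact Complex.ofReal_re _

/-- **The amplitude is the frame form at `(c₀, b) = (1, 0)`**: for `s < 0`,
`√(-s) ∫ ‖(1·√(-s)) • ∂ₜw(s,x) + D(w s)(x) 0‖² ρ_s = (-s)^{3/2} ∫ ‖∂ₜw(s,x)‖² ρ_s`
(`D(w s)(x) 0 = 0`, `‖√(-s) • v‖² = (-s)‖v‖²`, `√(-s)·(-s) = (-s)^{3/2}`). [folklore] -/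
theorem frameRigidityOf_frame_one_zero (w : ℝ → (EuclideanSpace ℝ (Fin 3)) → (EuclideanSpace ℝ (Fin 3))) {s : ℝ} (hs : s < 0) :
    Real.sqrt (-s) * ∫ x, ‖(1 * Real.sqrt (-s)) • timeDeriv w s x + fderiv ℝ (w s) x 0‖ ^ 2 *
        Real.exp (-(‖x‖ ^ 2) / (4 * (-s))) =
      (-s) ^ ((3 : ℝ) / 2) * ∫ x, ‖timeDeriv w s x‖ ^ 2 * Real.exp (-(‖x‖ ^ 2) / (4 * (-s))) := by
  have ha : 0 < -s := neg_pos.2 hs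
  have h1 : ∀ x : (EuclideanSpace ℝ (Fin 3)), ‖(1 * Real.sqrt (-s)) • timeDeriv w s x + fderiv ℝ (w s) x 0‖ ^ 2 *
      Real.exp (-(‖x‖ ^ 2) / (4 * (-s))) =
      (-s) * (‖timeDeriv w s x‖ ^ 2 * Real.exp (-(‖x‖ ^ 2) / (4 * (-s)))) := by
    intro x
    rw [map_zero, add_zero, one_mul, norm_smul, mul_pow, Real.norm_eq_abs, sq_abs,
      Real.sq_sqrt ha.le, mul_assoc]
  simp_rw [h1]
  rw [integral_const_mul, ← mul_assoc]
  congr 1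
  rw [show ((3 : ℝ) / 2) = 1 / 2 + 1 by norm_num, Real.rpow_add ha, Real.rpow_one,
    Real.sqrt_eq_rpow]

/-- The frame form is nonnegative. [folklore] -/
theorem frameRigidityOf_frame_nonneg (w : ℝ → (EuclideanSpace ℝ (Fin 3)) → (EuclideanSpace ℝ (Fin 3))) (s c : ℝ) (b : (EuclideanSpace ℝ (Fin 3))) :
    0 ≤ Real.sqrt (-s) * ∫ x, ‖(c * Real.sqrt (-s)) • timeDeriv w s x + fderiv ℝ (w s) x b‖ ^ 2 *
        Real.exp (-(‖x‖ ^ 2) / (4 * (-s))) :=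
  mul_nonneg (Real.sqrt_nonneg _)
    (integral_nonneg fun _ => mul_nonneg (sq_nonneg _) (Real.exp_nonneg _))

/-- Slices `x ↦ ∂ₜw(t, x)`, `t < 0`, of a field jointly smooth on the open slab `(-∞,0) × ℝ³` are
continuous (`∂ₜw = D(uncurry w)(t,x)(1,0)`, tree lemma `continuousOn_timeDeriv_of_contDiffOn`). [folklore] -/
theorem frameRigidityOf_continuous_timeDeriv {w : ℝ → (EuclideanSpace ℝ (Fin 3)) → (EuclideanSpace ℝ (Fin 3))}
    (hw : ContDiffOn ℝ (⊤ : ℕ∞) (Function.uncurry w) (Set.Iio 0 ×ˢ Set.univ)) {t : ℝ}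
    (ht : t < 0) : Continuous fun x => timeDeriv w t x :=
  (continuousOn_timeDeriv_of_contDiffOn isOpen_Iio
      (hw.of_le (by exact_mod_cast le_top))).comp_continuous
    (Continuous.prodMk_right t) fun x => mk_mem_prod (mem_Iio.2 ht) (mem_univ x)

/-- Directional derivatives `x ↦ D(w t)(x) b` of a slice `t < 0` of a jointly smooth field are
continuous (the slice is `C^∞`). [folklore] -/
theorem frameRigidityOf_continuous_fderiv_apply {w : ℝ → (EuclideanSpace ℝ (Fin 3)) → (EuclideanSpace ℝ (Fin 3))}
    (hw : ContDiffOn ℝ (⊤ : ℕ∞) (Function.uncurry w) (Set.Iio 0 ×ˢ Set.univ)) {t : ℝ}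
    (ht : t < 0) (b : (EuclideanSpace ℝ (Fin 3))) : Continuous fun x => fderiv ℝ (w t) x b :=
  ((contDiff_slice_of_contDiffOn hw (mem_Iio.2 ht)).continuous_fderiv (by simp)).clm_apply
    continuous_const

/-- **A vanishing frame has vanishing integrand**: if `V : ℝ³ → ℝ³` is continuous and bounded and
`√(-s) ∫ ‖V x‖² e^{-‖x‖²/(4(-s))} dx = 0` for some `s < 0`, then `V ≡ 0` (the integrand is
continuous, nonnegative and integrable against the Gaussian, so it vanishes a.e., hence
everywhere since Lebesgue measure charges open sets). [folklore] -/
theorem frameRigidityOf_eq_zero_of_frame_eq_zero {V : (EuclideanSpace ℝ (Fin 3)) → (EuclideanSpace ℝ (Fin 3))} {B s : ℝ} (hV : Continuous V)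
    (hB : ∀ x, ‖V x‖ ≤ B) (hs : s < 0)
    (h0 : Real.sqrt (-s) * ∫ x, ‖V x‖ ^ 2 * Real.exp (-(‖x‖ ^ 2) / (4 * (-s))) = 0) (x : (EuclideanSpace ℝ (Fin 3))) :
    V x = 0 := by
  have hs' : 0 < -s := neg_pos.2 hs
  have hint0 : ∫ x, ‖V x‖ ^ 2 * Real.exp (-(‖x‖ ^ 2) / (4 * (-s))) = 0 :=
    (mul_eq_zero.1 h0).resolve_left (Real.sqrt_pos.2 hs').ne'
  have hcont : Continuous fun x : (EuclideanSpace ℝ (Fin 3)) => ‖V x‖ ^ 2 * Real.exp (-(‖x‖ ^ 2) / (4 * (-s))) :=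
    (hV.norm.pow 2).mul (by fun_prop)
  have hgi : Integrable (fun x : (EuclideanSpace ℝ (Fin 3)) => ‖V x‖ ^ 2 * Real.exp (-(‖x‖ ^ 2) / (4 * (-s)))) := by
    refine ((frameRigidityOf_integrable_exp_neg_mul_sq_norm (b := 1 / (4 * (-s)))
      (by positivity)).const_mul (B ^ 2)).mono' hcont.aestronglyMeasurable
      (Eventually.of_forall fun x => ?_)
    rw [Real.norm_of_nonneg (mul_nonneg (sq_nonneg _) (Real.exp_nonneg _))]
    have h1 : Real.exp (-(‖x‖ ^ 2) / (4 * (-s))) = Real.exp (-(1 / (4 * (-s))) * ‖x‖ ^ 2) := by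
      congr 1
      ring
    rw [h1]
    exact mul_le_mul_of_nonneg_right (pow_le_pow_left₀ (norm_nonneg _) (hB x) 2)
      (Real.exp_nonneg _)
  have hae := (integral_eq_zero_iff_of_nonneg
    (fun x => mul_nonneg (sq_nonneg _) (Real.exp_nonneg _)) hgi).1 hint0
  have hzero := (hcont.ae_eq_iff_eq volume continuous_const).1 hae
  have hx : ‖V x‖ ^ 2 * Real.exp (-(‖x‖ ^ 2) / (4 * (-s))) = 0 := congr_fun hzero x
  rcases mul_eq_zero.1 hx with h | h
  · exact norm_eq_zero.1 ((pow_eq_zero_iff two_ne_zero).1 h)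
  · exact absurd h (Real.exp_ne_zero _)

/-- A field vanishing identically on `t < 0` has `∂ₜw(t, x) = 0` for `t < 0` (its time line is
locally constant). [folklore] -/
theorem frameRigidityOf_timeDeriv_eq_zero {w : ℝ → (EuclideanSpace ℝ (Fin 3)) → (EuclideanSpace ℝ (Fin 3))}
    (hw : ∀ t : ℝ, t < 0 → ∀ x, w t x = 0) {t : ℝ} (ht : t < 0) (x : (EuclideanSpace ℝ (Fin 3))) :
    timeDeriv w t x = 0 := by
  rw [timeDeriv_apply]
  have hev : (fun s => w s x) =ᶠ[𝓝 t] fun _ => (0 : (EuclideanSpace ℝ (Fin 3))) :=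
    Filter.eventually_of_mem (Iio_mem_nhds ht) fun s hs => hw s hs x
  rw [hev.deriv_eq, deriv_const]

/-- **Stub `stub_frameRigidity_of` — the composition (pure logic and topology)**: the statements
of the five analytic stubs of line `registered` — uniform scale-invariant sup bounds `hUB`, zoom
compactness with continuous convergence of the frame form `hZ`, boost Liouville `hB`, shear
rigidity `hSR`, shear Liouville `hSL` — imply FRAME RIGIDITY UNDER A CLOCK FLOOR: a clock floor
`a_u ≥ δ > 0` on `[-1,0)` forces a uniform lower bound `η > 0` of the frame form
`√(-t) ∫ ‖(c₀√(-t)) • ∂ₜu + ∂_b u‖² ρ_t` over `t ∈ [-1,0)` and `c₀² + ‖b‖² = 1`.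
Proof: a degenerating sequence `(tₙ, cₙ, bₙ)`; compactness of the unit ball of `ℝ × ℝ³`;
zoom by `Λₙ = √(-tₙ)` to a class element `v` keeping the floor (frame at `(1,0)` = amplitude)
with `frame_v(-1; c*, b*) = 0`; the integrand vanishes identically; `c* ≠ 0`: boost Liouville,
`c* = 0`: shear rigidity + shear Liouville; so `v ≡ 0`, contradicting `a_v(-1) ≥ δ`. [folklore] -/
theorem stub_frameRigidity_of :
    (∃ K : ℝ → ℝ, ∀ (C : ℝ) (u : ℝ → EuclideanSpace ℝ (Fin 3) → EuclideanSpace ℝ (Fin 3)), ContDiffOn ℝ (⊤ : ℕ∞) (Function.uncurry u) (Set.Iio 0 ×ˢ Set.univ) ∧ (∀ t < 0, Literature.Analysis.FluidPDE.VectorCalculus.IsDivFree (u t)) ∧ (∀ s t : ℝ, s < t → t < 0 → ∀ x, u t x = Literature.Analysis.FluidPDE.heatFlow (u s) (t - s) x - ∫ τ in Set.Ioo s t, ∫ y, ((-(inner ℝ (x - y) (u τ y) / (2 * (t - τ)) * Literature.Analysis.UnboundedOperators.heatKernel (t - τ) (x - y))) • u τ y + (∫ σ in Set.Ioi (t - τ),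 Literature.Analysis.UnboundedOperators.heatKernel σ (x - y) / (4 * σ ^ 2)) • (inner ℝ (x - y) (u τ y) • u τ y + inner ℝ (u τ y) (u τ y) • (x - y) + inner ℝ (x - y) (u τ y) • u τ y) - ((∫ σ in Set.Ioi (t - τ), Literature.Analysis.UnboundedOperators.heatKernel σ (x - y) / (8 * σ ^ 3)) * (inner ℝ (x - y) (u τ y) * inner ℝ (x - y) (u τ y))) • (x - y))) ∧ Literature.Analysis.FluidPDE.HasTypeITimeDecay C u ∧ (∀ (x₀ : EuclideanSpace ℝ (Fin 3)) (t₀ r : ℝ), t₀ ≤ 0 → 0 < r → (∀ t, t₀ - r ^ 2 < t → t < t₀ → r⁻¹ * ∫ x in Metric.ball x₀ r, ‖u t x‖ ^ 2 ≤ C) ∧ r⁻¹ * ∫ t in Set.Ioo (t₀ - r ^ 2) t₀, ∫ x in Metric.ball x₀ r, ‖fderiv ℝ (u t) x‖ ^ 2 ≤ C) → ∀ t : ℝ, t < 0 → ∀ x : EuclideanSpace ℝ (Fin 3), ‖Literature.Analysis.FluidPDE.timeDeriv u t x‖ ≤ K C * (-t) ^ (-(3 : ℝ) / 2) ∧ ‖fderiv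 ℝ (u t) x‖ ≤ K C * (-t) ^ (-(1 : ℝ)) ∧ ‖iteratedFDeriv ℝ 2 (u t) x‖ ≤ K C * (-t) ^ (-(3 : ℝ) / 2) ∧ ‖fderiv ℝ (fun y => Literature.Analysis.FluidPDE.timeDeriv u t y) x‖ ≤ K C * (-t) ^ (-(2 : ℝ)) ∧ ‖iteratedDeriv 2 (fun s => u s x) t‖ ≤ K C * (-t) ^ (-(5 : ℝ) / 2)) → ((∃ K : ℝ → ℝ, ∀ (C : ℝ) (u : ℝ → EuclideanSpace ℝ (Fin 3) → EuclideanSpace ℝ (Fin 3)), ContDiffOn ℝ (⊤ : ℕ∞) (Function.uncurry u) (Set.Iio 0 ×ˢ Set.univ) ∧ (∀ t < 0, Literature.Analysis.FluidPDE.VectorCalculus.IsDivFree (u t)) ∧ (∀ s t : ℝ, s < t → t < 0 → ∀ x, u t x = Literature.Analysis.FluidPDE.heatFlow (u s) (t - s) x - ∫ τ in Set.Ioo s t, ∫ y, ((-(inner ℝ (x - y) (u τ y) / (2 * (t - τ)) * Literature.Analysis.UnboundedOperators.heatKernel (t - τ) (x - y))) • u τ y + (∫ σ in Set.Ioi (t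 - τ), Literature.Analysis.UnboundedOperators.heatKernel σ (x - y) / (4 * σ ^ 2)) • (inner ℝ (x - y) (u τ y) • u τ y + inner ℝ (u τ y) (u τ y) • (x - y) + inner ℝ (x - y) (u τ y) • u τ y) - ((∫ σ in Set.Ioi (t - τ), Literature.Analysis.UnboundedOperators.heatKernel σ (x - y) / (8 * σ ^ 3)) * (inner ℝ (x - y) (u τ y) * inner ℝ (x - y) (u τ y))) • (x - y))) ∧ Literature.Analysis.FluidPDE.HasTypeITimeDecay C u ∧ (∀ (x₀ : EuclideanSpace ℝ (Fin 3)) (t₀ r : ℝ), t₀ ≤ 0 → 0 < r → (∀ t, t₀ - r ^ 2 < t → t < t₀ → r⁻¹ * ∫ x in Metric.ball x₀ r, ‖u t x‖ ^ 2 ≤ C) ∧ r⁻¹ * ∫ t in Set.Ioo (t₀ - r ^ 2) t₀, ∫ x in Metric.ball x₀ r, ‖fderiv ℝ (u t) x‖ ^ 2 ≤ C) → ∀ t : ℝ, t < 0 → ∀ x : EuclideanSpace ℝ (Fin 3), ‖Literature.Analysis.FluidPDE.timeDeriv u t x‖ ≤ K C * (-t) ^ (-(3 : ℝ) / 2) ∧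 ‖fderiv ℝ (u t) x‖ ≤ K C * (-t) ^ (-(1 : ℝ)) ∧ ‖iteratedFDeriv ℝ 2 (u t) x‖ ≤ K C * (-t) ^ (-(3 : ℝ) / 2) ∧ ‖fderiv ℝ (fun y => Literature.Analysis.FluidPDE.timeDeriv u t y) x‖ ≤ K C * (-t) ^ (-(2 : ℝ)) ∧ ‖iteratedDeriv 2 (fun s => u s x) t‖ ≤ K C * (-t) ^ (-(5 : ℝ) / 2)) → ∀ (C : ℝ) (u : ℝ → EuclideanSpace ℝ (Fin 3) → EuclideanSpace ℝ (Fin 3)), ContDiffOn ℝ (⊤ : ℕ∞) (Function.uncurry u) (Set.Iio 0 ×ˢ Set.univ) ∧ (∀ t < 0, Literature.Analysis.FluidPDE.VectorCalculus.IsDivFree (u t)) ∧ (∀ s t : ℝ, s < t → t < 0 → ∀ x, u t x = Literature.Analysis.FluidPDE.heatFlow (u s) (t - s) x - ∫ τ in Set.Ioo s t, ∫ y, ((-(inner ℝ (x - y) (u τ y) / (2 * (t - τ)) * Literature.Analysis.UnboundedOperators.heatKernel (t - τ) (x - y))) • u τ y + (∫ σ in Set.Ioi (t - τ), Literature.Analysis.UnboundedOperators.heatKernel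 σ (x - y) / (4 * σ ^ 2)) • (inner ℝ (x - y) (u τ y) • u τ y + inner ℝ (u τ y) (u τ y) • (x - y) + inner ℝ (x - y) (u τ y) • u τ y) - ((∫ σ in Set.Ioi (t - τ), Literature.Analysis.UnboundedOperators.heatKernel σ (x - y) / (8 * σ ^ 3)) * (inner ℝ (x - y) (u τ y) * inner ℝ (x - y) (u τ y))) • (x - y))) ∧ Literature.Analysis.FluidPDE.HasTypeITimeDecay C u ∧ (∀ (x₀ : EuclideanSpace ℝ (Fin 3)) (t₀ r : ℝ), t₀ ≤ 0 → 0 < r → (∀ t, t₀ - r ^ 2 < t → t < t₀ → r⁻¹ * ∫ x in Metric.ball x₀ r, ‖u t x‖ ^ 2 ≤ C) ∧ r⁻¹ * ∫ t in Set.Ioo (t₀ - r ^ 2) t₀, ∫ x in Metric.ball x₀ r, ‖fderiv ℝ (u t) x‖ ^ 2 ≤ C) → ∀ Λ : ℕ → ℝ, (∀ n, 0 < Λ n ∧ Λ n ≤ 1) → ∃ (φ : ℕ → ℕ) (v : ℝ → EuclideanSpace ℝ (Fin 3) → EuclideanSpace ℝ (Fin 3)), StrictMono φ ∧ (ContDiffOn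 ℝ (⊤ : ℕ∞) (Function.uncurry v) (Set.Iio 0 ×ˢ Set.univ) ∧ (∀ t < 0, Literature.Analysis.FluidPDE.VectorCalculus.IsDivFree (v t)) ∧ (∀ s t : ℝ, s < t → t < 0 → ∀ x, v t x = Literature.Analysis.FluidPDE.heatFlow (v s) (t - s) x - ∫ τ in Set.Ioo s t, ∫ y, ((-(inner ℝ (x - y) (v τ y) / (2 * (t - τ)) * Literature.Analysis.UnboundedOperators.heatKernel (t - τ) (x - y))) • v τ y + (∫ σ in Set.Ioi (t - τ), Literature.Analysis.UnboundedOperators.heatKernel σ (x - y) / (4 * σ ^ 2)) • (inner ℝ (x - y) (v τ y) • v τ y + inner ℝ (v τ y) (v τ y) • (x - y) + inner ℝ (x - y) (v τ y) • v τ y) - ((∫ σ in Set.Ioi (t - τ), Literature.Analysis.UnboundedOperators.heatKernel σ (x - y) / (8 * σ ^ 3)) * (inner ℝ (x - y) (v τ y) * inner ℝ (x - y) (v τ y))) • (x - y))) ∧ Literature.Analysis.FluidPDE.HasTypeITimeDecay C v ∧ (∀ (x₀ : EuclideanSpace ℝ (Fin 3)) (t₀ r : ℝ), t₀ ≤ 0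 → 0 < r → (∀ t, t₀ - r ^ 2 < t → t < t₀ → r⁻¹ * ∫ x in Metric.ball x₀ r, ‖v t x‖ ^ 2 ≤ C) ∧ r⁻¹ * ∫ t in Set.Ioo (t₀ - r ^ 2) t₀, ∫ x in Metric.ball x₀ r, ‖fderiv ℝ (v t) x‖ ^ 2 ≤ C)) ∧ ∀ t : ℝ, t < 0 → ∀ (c₀ : ℝ) (b : EuclideanSpace ℝ (Fin 3)) (c : ℕ → ℝ) (b' : ℕ → EuclideanSpace ℝ (Fin 3)), Filter.Tendsto c Filter.atTop (nhds c₀) → Filter.Tendsto b' Filter.atTop (nhds b) → Filter.Tendsto (fun k => Real.sqrt (-(Λ (φ k) ^ 2 * t)) * ∫ x, ‖(c k * Real.sqrt (-(Λ (φ k) ^ 2 * t))) • Literature.Analysis.FluidPDE.timeDeriv u (Λ (φ k) ^ 2 * t) x + fderiv ℝ (u (Λ (φ k) ^ 2 * t)) x (b' k)‖ ^ 2 * Real.exp (-(‖x‖ ^ 2) / (4 * (-(Λ (φ k) ^ 2 * t))))) Filter.atTop (nhds (Real.sqrt (-t) * ∫ x, ‖(c₀ * Real.sqrt (-t)) • Literature.Analysis.FluidPDE.timeDeriv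 v t x + fderiv ℝ (v t) x b‖ ^ 2 * Real.exp (-(‖x‖ ^ 2) / (4 * (-t)))))) → (∀ (C : ℝ) (u : ℝ → EuclideanSpace ℝ (Fin 3) → EuclideanSpace ℝ (Fin 3)), ContDiffOn ℝ (⊤ : ℕ∞) (Function.uncurry u) (Set.Iio 0 ×ˢ Set.univ) ∧ (∀ t < 0, Literature.Analysis.FluidPDE.VectorCalculus.IsDivFree (u t)) ∧ (∀ s t : ℝ, s < t → t < 0 → ∀ x, u t x = Literature.Analysis.FluidPDE.heatFlow (u s) (t - s) x - ∫ τ in Set.Ioo s t, ∫ y, ((-(inner ℝ (x - y) (u τ y) / (2 * (t - τ)) * Literature.Analysis.UnboundedOperators.heatKernel (t - τ) (x - y))) • u τ y + (∫ σ in Set.Ioi (t - τ), Literature.Analysis.UnboundedOperators.heatKernel σ (x - y) / (4 * σ ^ 2)) • (inner ℝ (x - y) (u τ y) • u τ y + inner ℝ (u τ y) (u τ y) • (x - y) + inner ℝ (x - y) (u τ y) • u τ y) - ((∫ σ in Set.Ioi (t - τ), Literature.Analysis.UnboundedOperators.heatKernel σ (x - y) / (8 * σ ^ 3)) * (inner ℝ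 (x - y) (u τ y) * inner ℝ (x - y) (u τ y))) • (x - y))) ∧ Literature.Analysis.FluidPDE.HasTypeITimeDecay C u ∧ (∀ (x₀ : EuclideanSpace ℝ (Fin 3)) (t₀ r : ℝ), t₀ ≤ 0 → 0 < r → (∀ t, t₀ - r ^ 2 < t → t < t₀ → r⁻¹ * ∫ x in Metric.ball x₀ r, ‖u t x‖ ^ 2 ≤ C) ∧ r⁻¹ * ∫ t in Set.Ioo (t₀ - r ^ 2) t₀, ∫ x in Metric.ball x₀ r, ‖fderiv ℝ (u t) x‖ ^ 2 ≤ C) → ∀ t₀ : ℝ, t₀ < 0 → ∀ (c₀ : ℝ) (b : EuclideanSpace ℝ (Fin 3)), c₀ ≠ 0 → (∀ x, (c₀ * Real.sqrt (-t₀)) • Literature.Analysis.FluidPDE.timeDeriv u t₀ x + fderiv ℝ (u t₀) x b = 0) → ∀ t : ℝ, t < 0 → ∀ x, u t x = 0) → (∀ (C : ℝ) (u : ℝ → EuclideanSpace ℝ (Fin 3) → EuclideanSpace ℝ (Fin 3)), ContDiffOn ℝ (⊤ : ℕ∞) (Function.uncurry u) (Set.Iio 0 ×ˢ Set.univ) ∧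 (∀ t < 0, Literature.Analysis.FluidPDE.VectorCalculus.IsDivFree (u t)) ∧ (∀ s t : ℝ, s < t → t < 0 → ∀ x, u t x = Literature.Analysis.FluidPDE.heatFlow (u s) (t - s) x - ∫ τ in Set.Ioo s t, ∫ y, ((-(inner ℝ (x - y) (u τ y) / (2 * (t - τ)) * Literature.Analysis.UnboundedOperators.heatKernel (t - τ) (x - y))) • u τ y + (∫ σ in Set.Ioi (t - τ), Literature.Analysis.UnboundedOperators.heatKernel σ (x - y) / (4 * σ ^ 2)) • (inner ℝ (x - y) (u τ y) • u τ y + inner ℝ (u τ y) (u τ y) • (x - y) + inner ℝ (x - y) (u τ y) • u τ y) - ((∫ σ in Set.Ioi (t - τ), Literature.Analysis.UnboundedOperators.heatKernel σ (x - y) / (8 * σ ^ 3)) * (inner ℝ (x - y) (u τ y) * inner ℝ (x - y) (u τ y))) • (x - y))) ∧ Literature.Analysis.FluidPDE.HasTypeITimeDecay C u ∧ (∀ (x₀ : EuclideanSpace ℝ (Fin 3)) (t₀ r : ℝ), t₀ ≤ 0 → 0 < r → (∀ t, t₀ - r ^ 2 < t → t < t₀ → r⁻¹ * ∫ x in Metric.ball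 x₀ r, ‖u t x‖ ^ 2 ≤ C) ∧ r⁻¹ * ∫ t in Set.Ioo (t₀ - r ^ 2) t₀, ∫ x in Metric.ball x₀ r, ‖fderiv ℝ (u t) x‖ ^ 2 ≤ C) → ∀ t₀ : ℝ, t₀ < 0 → ∀ b : EuclideanSpace ℝ (Fin 3), (∀ x, fderiv ℝ (u t₀) x b = 0) → ∀ t : ℝ, t < 0 → ∀ (x : EuclideanSpace ℝ (Fin 3)) (h : ℝ), u t (x + h • b) = u t x) → (∀ (C : ℝ) (u : ℝ → EuclideanSpace ℝ (Fin 3) → EuclideanSpace ℝ (Fin 3)), ContDiffOn ℝ (⊤ : ℕ∞) (Function.uncurry u) (Set.Iio 0 ×ˢ Set.univ) ∧ (∀ t < 0, Literature.Analysis.FluidPDE.VectorCalculus.IsDivFree (u t)) ∧ (∀ s t : ℝ, s < t → t < 0 → ∀ x, u t x = Literature.Analysis.FluidPDE.heatFlow (u s) (t - s) x - ∫ τ in Set.Ioo s t, ∫ y, ((-(inner ℝ (x - y) (u τ y) / (2 * (t - τ)) * Literature.Analysis.UnboundedOperators.heatKernel (t - τ) (x - y))) • u τ y + (∫ σ in Set.Ioi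 (t - τ), Literature.Analysis.UnboundedOperators.heatKernel σ (x - y) / (4 * σ ^ 2)) • (inner ℝ (x - y) (u τ y) • u τ y + inner ℝ (u τ y) (u τ y) • (x - y) + inner ℝ (x - y) (u τ y) • u τ y) - ((∫ σ in Set.Ioi (t - τ), Literature.Analysis.UnboundedOperators.heatKernel σ (x - y) / (8 * σ ^ 3)) * (inner ℝ (x - y) (u τ y) * inner ℝ (x - y) (u τ y))) • (x - y))) ∧ Literature.Analysis.FluidPDE.HasTypeITimeDecay C u ∧ (∀ (x₀ : EuclideanSpace ℝ (Fin 3)) (t₀ r : ℝ), t₀ ≤ 0 → 0 < r → (∀ t, t₀ - r ^ 2 < t → t < t₀ → r⁻¹ * ∫ x in Metric.ball x₀ r, ‖u t x‖ ^ 2 ≤ C) ∧ r⁻¹ * ∫ t in Set.Ioo (t₀ - r ^ 2) t₀, ∫ x in Metric.ball x₀ r, ‖fderiv ℝ (u t) x‖ ^ 2 ≤ C) → ∀ b : EuclideanSpace ℝ (Fin 3), b ≠ 0 → (∀ t : ℝ, t < 0 → ∀ (x : EuclideanSpace ℝ (Fin 3)) (h : ℝ), u t (x + h • b) = u t x) →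 ∀ t : ℝ, t < 0 → ∀ x, u t x = 0) → ∀ (C : ℝ) (u : ℝ → EuclideanSpace ℝ (Fin 3) → EuclideanSpace ℝ (Fin 3)), ContDiffOn ℝ (⊤ : ℕ∞) (Function.uncurry u) (Set.Iio 0 ×ˢ Set.univ) ∧ (∀ t < 0, Literature.Analysis.FluidPDE.VectorCalculus.IsDivFree (u t)) ∧ (∀ s t : ℝ, s < t → t < 0 → ∀ x, u t x = Literature.Analysis.FluidPDE.heatFlow (u s) (t - s) x - ∫ τ in Set.Ioo s t, ∫ y, ((-(inner ℝ (x - y) (u τ y) / (2 * (t - τ)) * Literature.Analysis.UnboundedOperators.heatKernel (t - τ) (x - y))) • u τ y + (∫ σ in Set.Ioi (t - τ), Literature.Analysis.UnboundedOperators.heatKernel σ (x - y) / (4 * σ ^ 2)) • (inner ℝ (x - y) (u τ y) • u τ y + inner ℝ (u τ y) (u τ y) • (x - y) + inner ℝ (x - y) (u τ y) • u τ y) - ((∫ σ in Set.Ioi (t - τ), Literature.Analysis.UnboundedOperators.heatKernel σ (x - y) / (8 * σ ^ 3)) * (inner ℝ (x - y) (u τ y) * inner ℝ (x - y) (u τ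 y))) • (x - y))) ∧ Literature.Analysis.FluidPDE.HasTypeITimeDecay C u ∧ (∀ (x₀ : EuclideanSpace ℝ (Fin 3)) (t₀ r : ℝ), t₀ ≤ 0 → 0 < r → (∀ t, t₀ - r ^ 2 < t → t < t₀ → r⁻¹ * ∫ x in Metric.ball x₀ r, ‖u t x‖ ^ 2 ≤ C) ∧ r⁻¹ * ∫ t in Set.Ioo (t₀ - r ^ 2) t₀, ∫ x in Metric.ball x₀ r, ‖fderiv ℝ (u t) x‖ ^ 2 ≤ C) → ∀ δ > 0, (∀ t : ℝ, -1 ≤ t → t < 0 → δ ≤ (-t) ^ ((3 : ℝ) / 2) * ∫ x, ‖Literature.Analysis.FluidPDE.timeDeriv u t x‖ ^ 2 * Real.exp (-(‖x‖ ^ 2) / (4 * (-t)))) → ∃ η > 0, ∀ t : ℝ, -1 ≤ t → t < 0 → ∀ (c₀ : ℝ) (b : EuclideanSpace ℝ (Fin 3)), c₀ ^ 2 + ‖b‖ ^ 2 = 1 → η ≤ Real.sqrt (-t) * ∫ x, ‖(c₀ * Real.sqrt (-t)) • Literature.Analysis.FluidPDE.timeDeriv u t x + fderiv ℝ (u t)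 x b‖ ^ 2 * Real.exp (-(‖x‖ ^ 2) / (4 * (-t))) := by
  intro hUB hZ hB hSR hSL C u hu δ hδ hfloor
  by_contra hcon
  have hm1 : (-1 : ℝ) < 0 := by norm_num
  -- (0) a degenerating sequence `(tₙ, cₙ, bₙ)`
  have key : ∀ n : ℕ, ∃ (t c₀ : ℝ) (b : EuclideanSpace ℝ (Fin 3)), -1 ≤ t ∧ t < 0 ∧
      c₀ ^ 2 + ‖b‖ ^ 2 = 1 ∧
      Real.sqrt (-t) * ∫ x, ‖(c₀ * Real.sqrt (-t)) • timeDeriv u t x + fderiv ℝ (u t) x b‖ ^ 2 *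
        Real.exp (-(‖x‖ ^ 2) / (4 * (-t))) < 1 / ((n : ℝ) + 1) := by
    intro n
    by_contra h'
    refine hcon ⟨1 / ((n : ℝ) + 1), by positivity, fun t ht1 ht2 c₀ b hcb => ?_⟩
    by_contra hlt
    exact h' ⟨t, c₀, b, ht1, ht2, hcb, not_le.mp hlt⟩
  choose tn cn bn htn1 htn2 hcb hlt using key
  -- (i) compactness of the parameters `(cₙ, bₙ)` in the closed unit ball of `ℝ × ℝ³`
  obtain ⟨p, -, ψ₀, hψ₀, hp⟩ :=
    (isCompact_closedBall (0 : ℝ × EuclideanSpace ℝ (Fin 3)) 1).tendsto_subseq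
      (x := fun n => (cn n, bn n)) fun n => by
        simp only [Metric.mem_closedBall, dist_zero_right, Prod.norm_mk, max_le_iff,
          Real.norm_eq_abs]
        exact ⟨(sq_le_one_iff_abs_le_one _).1 (by nlinarith [sq_nonneg ‖bn n‖, hcb n]),
          (pow_le_one_iff_of_nonneg (norm_nonneg _) two_ne_zero).1
            (by nlinarith [sq_nonneg (cn n), hcb n])⟩
  have hc : Tendsto (fun k => cn (ψ₀ k)) atTop (𝓝 p.1) := hp.fst_nhds
  have hb : Tendsto (fun k => bn (ψ₀ k)) atTop (𝓝 p.2) := hp.snd_nhds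
  have hcbs : p.1 ^ 2 + ‖p.2‖ ^ 2 = 1 :=
    tendsto_nhds_unique ((hc.pow 2).add (hb.norm.pow 2))
      (tendsto_const_nhds.congr fun k => (hcb (ψ₀ k)).symm)
  -- (ii) zoom by `Λₖ = √(-t_{ψ₀ k})`
  obtain ⟨Λ, hΛn⟩ : ∃ Λ : ℕ → ℝ, ∀ n, Λ n = Real.sqrt (-tn (ψ₀ n)) := ⟨_, fun _ => rfl⟩
  have hΛ : ∀ n, 0 < Λ n ∧ Λ n ≤ 1 := fun n => by
    rw [hΛn]
    exact ⟨Real.sqrt_pos.2 (neg_pos.2 (htn2 _)),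
      Real.sqrt_le_one.2 (by linarith [htn1 (ψ₀ n)])⟩
  have hΛsq : ∀ k, Λ k ^ 2 * -1 = tn (ψ₀ k) := fun k => by
    rw [hΛn, Real.sq_sqrt (neg_pos.2 (htn2 _)).le]
    ring
  obtain ⟨φ, v, hφ, hv, hconv⟩ := hZ hUB C u hu Λ hΛ
  -- (iii) the clock floor passes to `v` at `t = -1` (frame at `(1, 0)` is the amplitude)
  have h1 := hconv (-1) hm1 1 0 (fun _ => 1) (fun _ => 0) tendsto_const_nhds tendsto_const_nhds
  have hAv : δ ≤ _ := ge_of_tendsto' h1 fun k => by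
    beta_reduce
    rw [hΛsq (φ k), frameRigidityOf_frame_one_zero u (htn2 _)]
    exact hfloor _ (htn1 _) (htn2 _)
  rw [frameRigidityOf_frame_one_zero v hm1] at hAv
  -- (iv) the frame of `v` at `(-1; c*, b*)` vanishes (squeeze `0 ≤ frame < 1/(n+1)`)
  have h2 := hconv (-1) hm1 p.1 p.2 (fun k => cn (ψ₀ (φ k))) (fun k => bn (ψ₀ (φ k)))
    (hc.comp hφ.tendsto_atTop) (hb.comp hφ.tendsto_atTop)
  have h0 := tendsto_nhds_unique h2
    (tendsto_of_tendsto_of_tendsto_of_le_of_le tendsto_const_nhds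
      (tendsto_one_div_add_atTop_nhds_zero_nat (𝕜 := ℝ))
      (fun k => by
        beta_reduce
        exact frameRigidityOf_frame_nonneg u _ _ _)
      (fun k => by
        beta_reduce
        rw [hΛsq (φ k)]
        refine (hlt (ψ₀ (φ k))).le.trans ?_
        have hk : k ≤ ψ₀ (φ k) := (hψ₀.comp hφ).le_apply
        exact one_div_le_one_div_of_le (by positivity) (by exact_mod_cast Nat.add_le_add_right hk 1)))
  -- (v) the integrand of the vanishing frame is continuous and bounded, hence identically zero
  obtain ⟨K, hK⟩ := hUB
  have hVc : Continuous fun x => (p.1 * Real.sqrt (-(-1 : ℝ))) • timeDeriv v (-1) x +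
      fderiv ℝ (v (-1)) x p.2 :=
    ((frameRigidityOf_continuous_timeDeriv hv.1 hm1).fun_const_smul
      (p.1 * Real.sqrt (-(-1 : ℝ)))).fun_add (frameRigidityOf_continuous_fderiv_apply hv.1 hm1 p.2)
  have hVB : ∀ x, ‖(p.1 * Real.sqrt (-(-1 : ℝ))) • timeDeriv v (-1) x + fderiv ℝ (v (-1)) x p.2‖ ≤
      ‖p.1 * Real.sqrt (-(-1 : ℝ))‖ * (K C * (-(-1 : ℝ)) ^ (-(3 : ℝ) / 2)) +
        K C * (-(-1 : ℝ)) ^ (-(1 : ℝ)) * ‖p.2‖ := fun x => by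
    obtain ⟨hK1, hK2, -, -, -⟩ := hK C v hv (-1) hm1 x
    refine (norm_add_le _ _).trans (add_le_add ?_ ?_)
    · rw [norm_smul]
      exact mul_le_mul_of_nonneg_left hK1 (norm_nonneg _)
    · exact (ContinuousLinearMap.le_opNorm _ _).trans
        (mul_le_mul_of_nonneg_right hK2 (norm_nonneg _))
  have hV0 : ∀ x, (p.1 * Real.sqrt (-(-1 : ℝ))) • timeDeriv v (-1) x +
      fderiv ℝ (v (-1)) x p.2 = 0 :=
    frameRigidityOf_eq_zero_of_frame_eq_zero hVc hVB hm1 h0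
  -- (vi) Liouville: `c* ≠ 0` boost, `c* = 0` shear rigidity + shear Liouville
  have hv0 : ∀ t : ℝ, t < 0 → ∀ x, v t x = 0 := by
    by_cases hc0 : p.1 = 0
    · have hb0 : p.2 ≠ 0 := by
        intro hb0
        rw [hc0, hb0, norm_zero] at hcbs
        norm_num at hcbs
      have hV0' : ∀ x, fderiv ℝ (v (-1)) x p.2 = 0 := fun x => by
        have := hV0 x
        rwa [hc0, zero_mul, zero_smul, zero_add] at this
      exact hSL C v hv p.2 hb0 (hSR C v hv (-1) hm1 p.2 hV0')
    · exact hB C v hv (-1) hm1 p.1 p.2 hc0 hV0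
  -- (vii) `a_v(-1) = 0 < δ ≤ a_v(-1)`
  have htd : ∀ x, timeDeriv v (-1) x = 0 := fun x => frameRigidityOf_timeDeriv_eq_zero hv0 hm1 x
  simp only [htd, norm_zero, ne_eq, OfNat.ofNat_ne_zero, not_false_eq_true, zero_pow, zero_mul,
    integral_zero, mul_zero] at hAv
  exact absurd hAv (not_le.2 hδ)


/-- **Stub `stub_frameRigidity` — FRAME RIGIDITY UNDER A CLOCK FLOOR** (the theorem-candidate half of
the birth skeleton of crux `ClockCeiling`, line `registered`): for an element `u` of the route's
Type-I class and `δ > 0`, if the clock amplitude stays `≥ δ` on `[-1,0)` then the frame form is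
bounded below on `[-1,0) × {c₀² + ‖b‖² = 1}`. Proof: the composition `stub_frameRigidity_of`
applied to the landed pieces `stub_uniformBounds`, `stub_zoomCompactness`, `stub_boostLiouville`,
`stub_shearRigidity`, `stub_shearLiouville`. [cite: KochNadirashviliSereginSverak2009, Lemma 6.1, Prop. 4.1, Thm 6.2 proof (arXiv:0709.3599)] -/
theorem stub_frameRigidity :
    ∀ (C : ℝ) (u : ℝ → EuclideanSpace ℝ (Fin 3) → EuclideanSpace ℝ (Fin 3)), ContDiffOn ℝ (⊤ : ℕ∞) (Function.uncurry u) (Set.Iio 0 ×ˢ Set.univ) ∧ (∀ t < 0, Literature.Analysis.FluidPDE.VectorCalculus.IsDivFree (u t)) ∧ (∀ s t : ℝ, s < t → t < 0 → ∀ x, u t x = Literature.Analysis.FluidPDE.heatFlow (u s) (t - s) x - ∫ τ in Set.Ioo s t, ∫ y, ((-(inner ℝ (x - y) (u τ y) / (2 * (t - τ)) * Literature.Analysis.UnboundedOperators.heatKernel (t - τ) (x - y))) • u τ y + (∫ σ in Set.Ioi (t - τ), Literature.Analysis.UnboundedOperators.heatKernel σ (x - y) / (4 * σ ^ 2)) •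 (inner ℝ (x - y) (u τ y) • u τ y + inner ℝ (u τ y) (u τ y) • (x - y) + inner ℝ (x - y) (u τ y) • u τ y) - ((∫ σ in Set.Ioi (t - τ), Literature.Analysis.UnboundedOperators.heatKernel σ (x - y) / (8 * σ ^ 3)) * (inner ℝ (x - y) (u τ y) * inner ℝ (x - y) (u τ y))) • (x - y))) ∧ Literature.Analysis.FluidPDE.HasTypeITimeDecay C u ∧ (∀ (x₀ : EuclideanSpace ℝ (Fin 3)) (t₀ r : ℝ), t₀ ≤ 0 → 0 < r → (∀ t, t₀ - r ^ 2 < t → t < t₀ → r⁻¹ * ∫ x in Metric.ball x₀ r, ‖u t x‖ ^ 2 ≤ C) ∧ r⁻¹ * ∫ t in Set.Ioo (t₀ - r ^ 2) t₀, ∫ x in Metric.ball x₀ r, ‖fderiv ℝ (u t) x‖ ^ 2 ≤ C) → ∀ δ > 0, (∀ t : ℝ, -1 ≤ t → t < 0 → δ ≤ (-t) ^ ((3 : ℝ) / 2) * ∫ x, ‖Literature.Analysis.FluidPDE.timeDeriv u t x‖ ^ 2 * Real.exp (-(‖x‖ ^ 2) / (4 * (-t)))) → ∃ η > 0, ∀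 t : ℝ, -1 ≤ t → t < 0 → ∀ (c₀ : ℝ) (b : EuclideanSpace ℝ (Fin 3)), c₀ ^ 2 + ‖b‖ ^ 2 = 1 → η ≤ Real.sqrt (-t) * ∫ x, ‖(c₀ * Real.sqrt (-t)) • Literature.Analysis.FluidPDE.timeDeriv u t x + fderiv ℝ (u t) x b‖ ^ 2 * Real.exp (-(‖x‖ ^ 2) / (4 * (-t))) :=
  stub_frameRigidity_of stub_uniformBounds (fun _ => stub_zoomCompactness) stub_boostLiouville
    stub_shearRigidity stub_shearLiouville

end Summit.NavierStokesRegularity.NavierStokesRegularity.Theorems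

end
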